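import Mathlib
import Summits.ValiantsHypothesis.ValiantsHypothesis.Theses.NewtonUnitEquations
import Summits.ValiantsHypothesis.ValiantsHypothesis.Theorems.NewtonUnitEquationsDissociatedFixedKExposedWord
import Summits.ValiantsHypothesis.ValiantsHypothesis.Theorems.NewtonUnitEquationsDissociatedFixedKSweep

/-!
# `BinomialPencil` (stmt-ValiantsHypothesis-5908, route NewtonUnitEquations, support item, rank 9)

For binomials `1 + α_j X^{d_j}`, `1 + β_j X^{d_j}` (`j < m`) with common bivariate exponents `d_j`
having DISTINCT SUBSET SUMS and `α_j ≠ 0`, the Newton polygon of the pencil member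
`Π_j (1 + α_j X^{d_j}) − c · Π_j (1 + β_j X^{d_j})` has at most `46 (m+1)²` vertices
(`binomialPencil_proof` closes `…Theses.NewtonUnitEquations.BinomialPencil` with `C = 46`; the
route's hypothesis `β_j ≠ 0` is not needed).  Proof = the route card's cube-independence argument,
made tie-robust (no perturbation to generic directions, no Minkowski sums for common factors):
* §1 the pencil member is `Σ_T (α_T − c β_T) X^{d_T}` (`α_T = Π_{j∈T} α_j`, `d_T = Σ_{j∈T} d_j`);
  by distinct subset sums its support is `{d_T : T ∉ Z}`, `Z = {T : α_T = c β_T}`.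
* §2 (cube lemma) with `E = {j : α_j = β_j}`, `Z` is closed under `T ↦ T △ F` (`F ⊆ E`) and has
  no cube edge `T — T △ {j}`, `j ∉ E` (uses `α_T ≠ 0`).  For ANY real weights `h_j`, heights
  `h(T) = Σ_{j∈T} h_j = h(S⁺) − Σ_{T △ S⁺} |h_j|`, a survivor `S ∉ Z` strictly higher than every
  other survivor is `S⁺ = {j : 0 < h_j}` or `S⁺ △ J` with `J = argmin_{j∉E} |h_j|` (then a singleton).
* §3 `(S⁺, J)` for `h_j = l(d_j)` is decoded from the comparison pattern of `l` on the `≤ 2m+1`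
  probes `{0, ±d_j}`; `ncard_range_cmpPat_le` (file `…DissociatedFixedKSweep`) counts
  `≤ 4(2m+1)² + 7` patterns.
* §4 every vertex is strictly exposed (`exists_strict_sep_of_mem_extremePoints_convexHull`, file
  `…DissociatedFixedKExposedWord`), so the vertex set lies in the image of the pattern set under two
  maps: `#vertices ≤ 2 (4(2m+1)² + 7) ≤ 46 (m+1)²`.

[folklore; setting of KPTT arXiv:1308.2286 §2; the statement is the route card's own (2,2) rung]
-/

namespace Summit.ValiantsHypothesis.Theorems.BinomialPencil

open scoped BigOperators Classical symmDiff
open Finset MvPolynomial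
open Summit.ValiantsHypothesis.ValiantsHypothesis.Theorems.DissociatedFixedK.Negative (emb emb_injective)
open Summit.ValiantsHypothesis.Theorems.DissociatedFixedK (cmpPat ncard_range_cmpPat_le
  exists_strict_sep_of_mem_extremePoints_convexHull)

noncomputable section

variable {m : ℕ} (d : Fin m → (Fin 2 →₀ ℕ)) (α β : Fin m → ℂ) (c : ℂ)

/-! ## §1  Algebra: the pencil member, its expansion and its support -/

/-- The pencil member `Π_j (1 + α_j X^{d_j}) − c · Π_j (1 + β_j X^{d_j})` (literal subterm of the
route decl `BinomialPencil`). -/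
def pencil : MvPolynomial (Fin 2) ℂ :=
  (∏ j, (1 + C (α j) * monomial (d j) 1)) - C c * ∏ j, (1 + C (β j) * monomial (d j) 1)

/-- Expansion of a product of binomials: `Π_j (1 + α_j X^{d_j}) = Σ_T α_T X^{d_T}`. [folklore] -/
theorem prod_binomial_eq_sum :
    (∏ j, (1 + C (α j) * monomial (d j) 1) : MvPolynomial (Fin 2) ℂ) =
      ∑ T : Finset (Fin m), monomial (∑ j ∈ T, d j) (∏ j ∈ T, α j) := by
  simp_rw [C_mul_monomial, mul_one]
  rw [Finset.prod_one_add, Finset.powerset_univ]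
  exact Finset.sum_congr rfl (fun T _ => by rw [monomial_sum_prod])

/-- The coefficient function of the pencil on subsets, `coef T = α_T − c β_T`; the cancellation
set is `Z = {T : coef T = 0}`. -/
def coef (T : Finset (Fin m)) : ℂ := (∏ j ∈ T, α j) - c * ∏ j ∈ T, β j

/-- The pencil member is `Σ_T (α_T − c β_T) X^{d_T}`. [folklore] -/
theorem pencil_eq_sum :
    pencil d α β c = ∑ T : Finset (Fin m), monomial (∑ j ∈ T, d j) (coef α β c T) := by
  unfold pencil coef
  rw [prod_binomial_eq_sum, prod_binomial_eq_sum, Finset.mul_sum, ← Finset.sum_sub_distrib]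
  exact Finset.sum_congr rfl (fun T _ => by rw [C_mul_monomial, ← map_sub])

/-- Coefficient formula: under distinct subset sums, `coeff_{d_S} = α_S − c β_S`. [folklore] -/
theorem coeff_pencil (hd : ∀ S T : Finset (Fin m), ∑ j ∈ S, d j = ∑ j ∈ T, d j → S = T)
    (S : Finset (Fin m)) : coeff (∑ j ∈ S, d j) (pencil d α β c) = coef α β c S := by
  rw [pencil_eq_sum, coeff_sum, Finset.sum_eq_single S]
  · rw [coeff_monomial, if_pos rfl]
  · intro T _ hTS
    rw [coeff_monomial, if_neg]
    exact fun h => hTS (hd T S h)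
  · exact fun h => absurd (Finset.mem_univ S) h

/-- Support formula: every exponent in the support of the pencil member is a subset sum `d_S`.
[folklore] -/
theorem exists_eq_sum_of_mem_support {e : Fin 2 →₀ ℕ} (he : e ∈ (pencil d α β c).support) :
    ∃ S : Finset (Fin m), e = ∑ j ∈ S, d j := by
  rw [pencil_eq_sum] at he
  obtain ⟨T, -, hT⟩ := Finset.mem_biUnion.mp (support_sum he)
  exact ⟨T, by simpa using support_monomial_subset hT⟩

/-- The exponent embedding `ℕ² → ℝ²` is additive, hence commutes with finite sums. -/
theorem emb_sum {ι : Type*} (T : Finset ι) (f : ι → Fin 2 →₀ ℕ) :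
    emb (∑ j ∈ T, f j) = ∑ j ∈ T, emb (f j) :=
  map_sum ({ toFun := emb
             map_zero' := by ext i; simp [emb]
             map_add' := fun e e' => by ext i; simp [emb] } : (Fin 2 →₀ ℕ) →+ (Fin 2 → ℝ)) f T

/-! ## §2  The cube lemma (pure combinatorics of a cancellation set) -/

/-- The top set of the weights `h`: `S⁺ = {j : 0 < h_j}`. -/
def splus (h : Fin m → ℝ) : Finset (Fin m) := univ.filter fun j => 0 < h j

/-- The argmin set `J = {j ∉ E : |h_j| ≤ |h_i| for all i ∉ E}`. -/
def jset (E : Finset (Fin m)) (h : Fin m → ℝ) : Finset (Fin m) :=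
  univ.filter fun j => j ∉ E ∧ ∀ i, i ∉ E → |h j| ≤ |h i|

/-- Height bookkeeping: `h(T) = h(S⁺) − Σ_{j ∈ T △ S⁺} |h_j|`. [folklore] -/
theorem sum_eq_sum_splus_sub (h : Fin m → ℝ) (T : Finset (Fin m)) :
    ∑ j ∈ T, h j = ∑ j ∈ splus h, h j - ∑ j ∈ T ∆ splus h, |h j| := by
  have h1 : ∑ j ∈ T \ splus h, h j = -∑ j ∈ T \ splus h, |h j| := by
    rw [← Finset.sum_neg_distrib]
    refine Finset.sum_congr rfl (fun j hj => ?_)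
    have : ¬ 0 < h j := by simpa [splus] using (Finset.mem_sdiff.mp hj).2
    rw [abs_of_nonpos (not_lt.mp this), neg_neg]
  have h2 : ∑ j ∈ splus h \ T, h j = ∑ j ∈ splus h \ T, |h j| := by
    refine Finset.sum_congr rfl (fun j hj => ?_)
    have : 0 < h j := by simpa [splus] using (Finset.mem_sdiff.mp hj).1
    rw [abs_of_pos this]
  have h3 := Finset.sum_sdiff_sub_sum_sdiff (s₁ := splus h) (s₂ := T) (f := h)
  rw [Finset.symmDiff_def, Finset.sum_union disjoint_sdiff_sdiff]
  linarith

/-- **Cube lemma.**  Let `Z` (cancelled sets) contain no cube edge in a direction outside `E` and be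
closed under symmetric difference with subsets of `E`.  If a survivor `S ∉ Z` is STRICTLY higher
(for the heights `h(T) = Σ_{j∈T} h_j`) than every other survivor, then `S = S⁺` or `S = S⁺ △ J`
with `S⁺ = {j : 0 < h_j}` and `J` the argmin set of `|h|` outside `E`. [folklore] -/
theorem eq_splus_or_eq_splus_symmDiff_jset (E : Finset (Fin m)) (Z : Finset (Fin m) → Prop)
    (hZ1 : ∀ (T : Finset (Fin m)) (j : Fin m), j ∉ E → Z T → ¬ Z (T ∆ {j}))
    (hZ2 : ∀ T T' : Finset (Fin m), Z T → T ∆ T' ⊆ E → Z T')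
    (h : Fin m → ℝ) (S : Finset (Fin m)) (hS : ¬ Z S)
    (hmax : ∀ T : Finset (Fin m), ¬ Z T → T ≠ S → ∑ j ∈ T, h j < ∑ j ∈ S, h j) :
    S = splus h ∨ S = splus h ∆ jset E h := by
  have eS := sum_eq_sum_splus_sub h S
  have hnonneg : ∀ T : Finset (Fin m), 0 ≤ ∑ j ∈ T, |h j| :=
    fun T => Finset.sum_nonneg (fun j _ => abs_nonneg (h j))
  by_cases hZ : Z (splus h)
  · right
    -- a coordinate outside `E` where `S` and `S⁺` differ
    have hnot : ¬ (splus h ∆ S ⊆ E) := fun hsub => hS (hZ2 _ _ hZ hsub)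
    obtain ⟨j₀, hj₀, hj₀E⟩ := Finset.not_subset.mp hnot
    have hj₀' : j₀ ∈ S ∆ splus h := by rwa [symmDiff_comm] at hj₀
    -- every argmin `j` gives the survivor `S⁺ △ {j}`, at least as high as `S`
    have key : ∀ j ∈ jset E h, splus h ∆ {j} = S := by
      intro j hj
      simp only [jset, Finset.mem_filter, Finset.mem_univ, true_and] at hj
      obtain ⟨hjE, hjmin⟩ := hj
      by_contra hne
      have hlt := hmax _ (hZ1 _ j hjE hZ) hne
      have e1 := sum_eq_sum_splus_sub h (splus h ∆ {j})
      rw [symmDiff_symmDiff_self', Finset.sum_singleton] at e1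
      have hb1 : |h j| ≤ |h j₀| := hjmin j₀ hj₀E
      have hb2 : |h j₀| ≤ ∑ k ∈ S ∆ splus h, |h k| :=
        Finset.single_le_sum (f := fun k => |h k|) (fun k _ => abs_nonneg (h k)) hj₀'
      linarith
    -- the argmin set is nonempty, hence (by `key`) the singleton `{j₁}`
    have hne' : (univ.filter fun j : Fin m => j ∉ E).Nonempty := ⟨j₀, by simp [hj₀E]⟩
    obtain ⟨j₁, hj₁, hj₁min⟩ := Finset.exists_min_image _ (fun j => |h j|) hne'
    have hj₁J : j₁ ∈ jset E h := by
      simp only [Finset.mem_filter, Finset.mem_univ, true_and] at hj₁ hj₁min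
      simp only [jset, Finset.mem_filter, Finset.mem_univ, true_and]
      exact ⟨hj₁, fun i hi => hj₁min i hi⟩
    have hJ : jset E h = {j₁} := by
      refine Finset.eq_singleton_iff_unique_mem.mpr ⟨hj₁J, fun j hj => ?_⟩
      have := (key j hj).trans (key j₁ hj₁J).symm
      exact Finset.singleton_inj.mp (symmDiff_right_inj.mp this)
    rw [hJ, key j₁ hj₁J]
  · left
    by_contra hne
    have hlt := hmax _ hZ (Ne.symm hne)
    have := hnonneg (S ∆ splus h)
    linarith

/-! ## §2b  The cancellation set of the pencil satisfies the cube lemma's hypotheses -/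

/-- The coincidence set `E = {j : α_j = β_j}`. -/
def coinc : Finset (Fin m) := univ.filter fun j => α j = β j

/-- No cube edge inside `Z` in a direction `j ∉ E` (insert form): `T, insert j T ∈ Z ⇒ α_j = β_j`
(uses `α_T ≠ 0`). [folklore] -/
theorem eq_of_coef_insert_eq_zero (hα : ∀ j, α j ≠ 0) {T : Finset (Fin m)} {j : Fin m}
    (hj : j ∉ T) (h1 : coef α β c T = 0) (h2 : coef α β c (insert j T) = 0) : α j = β j := by
  unfold coef at h1 h2
  rw [Finset.prod_insert hj, Finset.prod_insert hj] at h2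
  have hA : (∏ i ∈ T, α i) ≠ 0 := Finset.prod_ne_zero_iff.mpr (fun i _ => hα i)
  have h3 : (α j - β j) * ∏ i ∈ T, α i = 0 := by linear_combination h2 - (β j) * h1
  rcases mul_eq_zero.mp h3 with h | h
  · exact sub_eq_zero.mp h
  · exact absurd h hA

/-- No cube edge inside `Z` in a direction outside `E` (symmetric-difference form). [folklore] -/
theorem coef_symmDiff_singleton_ne_zero (hα : ∀ j, α j ≠ 0) (T : Finset (Fin m)) (j : Fin m)
    (hjE : j ∉ coinc α β) (hT : coef α β c T = 0) : ¬ coef α β c (T ∆ {j}) = 0 := by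
  have hne : α j ≠ β j := by simpa [coinc] using hjE
  intro hT'
  by_cases hjT : j ∈ T
  · have hEq : T ∆ {j} = T.erase j := by
      ext k
      simp only [Finset.mem_symmDiff, Finset.mem_singleton, Finset.mem_erase]
      constructor
      · rintro (⟨hk, hkj⟩ | ⟨rfl, hk⟩)
        · exact ⟨hkj, hk⟩
        · exact absurd hjT hk
      · exact fun ⟨hkj, hk⟩ => Or.inl ⟨hk, hkj⟩
    rw [hEq] at hT'
    exact hne (eq_of_coef_insert_eq_zero α β c hα (Finset.notMem_erase j T) hT'
      (by rwa [Finset.insert_erase hjT]))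
  · have hEq : T ∆ {j} = insert j T := by
      ext k
      simp only [Finset.mem_symmDiff, Finset.mem_singleton, Finset.mem_insert]
      constructor
      · rintro (⟨hk, _⟩ | ⟨rfl, _⟩)
        · exact Or.inr hk
        · exact Or.inl rfl
      · rintro (rfl | hk)
        · exact Or.inr ⟨rfl, hjT⟩
        · exact Or.inl ⟨hk, fun h => hjT (h ▸ hk)⟩
    rw [hEq] at hT'
    exact hne (eq_of_coef_insert_eq_zero α β c hα hjT hT hT')

/-- Reduction modulo `E`: `T ∈ Z ↔ T ∖ E ∈ Z` (on `E` the two binomials coincide). [folklore] -/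
theorem coef_eq_zero_iff_filter (hα : ∀ j, α j ≠ 0) (T : Finset (Fin m)) :
    coef α β c T = 0 ↔ coef α β c (T.filter fun j => j ∉ coinc α β) = 0 := by
  have hK : (∏ j ∈ T.filter (fun j => ¬ (j ∉ coinc α β)), α j) ≠ 0 :=
    Finset.prod_ne_zero_iff.mpr (fun i _ => hα i)
  have hBE : ∏ j ∈ T.filter (fun j => ¬ (j ∉ coinc α β)), β j =
      ∏ j ∈ T.filter (fun j => ¬ (j ∉ coinc α β)), α j :=
    Finset.prod_congr rfl (fun j hj => by
      have : j ∈ coinc α β := by simpa using (Finset.mem_filter.mp hj).2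
      exact (by simpa [coinc] using this : α j = β j).symm)
  have key : coef α β c T = coef α β c (T.filter fun j => j ∉ coinc α β) *
      ∏ j ∈ T.filter (fun j => ¬ (j ∉ coinc α β)), α j := by
    unfold coef
    rw [← Finset.prod_filter_mul_prod_filter_not T (fun j => j ∉ coinc α β) α,
      ← Finset.prod_filter_mul_prod_filter_not T (fun j => j ∉ coinc α β) β, hBE]
    ring
  rw [key, mul_eq_zero, or_iff_left hK]

/-- `Z` is closed under symmetric difference with subsets of `E`. [folklore] -/
theorem coef_eq_zero_of_symmDiff_subset (hα : ∀ j, α j ≠ 0) (T T' : Finset (Fin m))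
    (hT : coef α β c T = 0) (hsub : T ∆ T' ⊆ coinc α β) : coef α β c T' = 0 := by
  have hfilter : (T.filter fun j => j ∉ coinc α β) = T'.filter fun j => j ∉ coinc α β := by
    ext k
    simp only [Finset.mem_filter]
    constructor
    · rintro ⟨hk, hkE⟩
      refine ⟨?_, hkE⟩
      by_contra hk'
      exact hkE (hsub (Finset.mem_symmDiff.mpr (Or.inl ⟨hk, hk'⟩)))
    · rintro ⟨hk, hkE⟩
      refine ⟨?_, hkE⟩
      by_contra hk'
      exact hkE (hsub (Finset.mem_symmDiff.mpr (Or.inr ⟨hk, hk'⟩)))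
  rw [coef_eq_zero_iff_filter α β c hα] at hT ⊢
  rwa [← hfilter]

/-! ## §3  Pattern data: `(S⁺, J)` is read off the comparison pattern on `{0, ±d_j}` -/

/-- The probe set `P = {0} ∪ {d_j} ∪ {−d_j} ⊂ ℝ²`. -/
def probes : Finset (Fin 2 → ℝ) :=
  insert 0 ((univ.image fun j => emb (d j)) ∪ (univ.image fun j => -emb (d j)))

/-- `|P| ≤ 2m + 1`. -/
theorem card_probes_le : (probes d).card ≤ 2 * m + 1 := by
  unfold probes
  refine (Finset.card_insert_le _ _).trans ?_
  have h1 := Finset.card_union_le (univ.image fun j => emb (d j)) (univ.image fun j => -emb (d j))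
  have h2 : (univ.image fun j : Fin m => emb (d j)).card ≤ m :=
    Finset.card_image_le.trans (by simp)
  have h3 : (univ.image fun j : Fin m => -emb (d j)).card ≤ m :=
    Finset.card_image_le.trans (by simp)
  omega

/-- The probe `0`. -/
def probe0 : ↥(probes d) := ⟨0, Finset.mem_insert_self _ _⟩

/-- The probe `d_j`. -/
def probeP (j : Fin m) : ↥(probes d) :=
  ⟨emb (d j), Finset.mem_insert_of_mem
    (Finset.mem_union_left _ (Finset.mem_image_of_mem _ (Finset.mem_univ j)))⟩

/-- The probe `−d_j`. -/
def probeM (j : Fin m) : ↥(probes d) :=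
  ⟨-emb (d j), Finset.mem_insert_of_mem
    (Finset.mem_union_right _ (Finset.mem_image_of_mem _ (Finset.mem_univ j)))⟩

/-- Decoding a comparison pattern `π` on the probes into the pair `(S⁺, J)`. -/
def decode (E : Finset (Fin m)) (π : ↥(probes d) × ↥(probes d) → Bool) :
    Finset (Fin m) × Finset (Fin m) :=
  (univ.filter fun j => π (probe0 d, probeP d j) = true,
   univ.filter fun j => j ∉ E ∧ ∀ i, i ∉ E →
     ¬ ((π (probeM d i, probeP d j) = true ∨ π (probeM d i, probeM d j) = true) ∧
        (π (probeP d i, probeP d j) = true ∨ π (probeP d i, probeM d j) = true)))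

/-- The decoded first component of the pattern of `l` is the top set `S⁺` of `h_j = l(d_j)`. -/
theorem decode_cmpPat_fst (E : Finset (Fin m)) (l : (Fin 2 → ℝ) →L[ℝ] ℝ) :
    (decode d E (cmpPat (probes d) l)).1 = splus (fun j => l (emb (d j))) := by
  ext j
  simp [decode, splus, cmpPat, probe0, probeP]

/-- The decoded second component of the pattern of `l` is the argmin set `J` of `|l(d_j)|`
outside `E`. -/
theorem decode_cmpPat_snd (E : Finset (Fin m)) (l : (Fin 2 → ℝ) →L[ℝ] ℝ) :
    (decode d E (cmpPat (probes d) l)).2 = jset E (fun j => l (emb (d j))) := by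
  -- `|a| < |b|` through four sign-free comparisons
  have key : ∀ a b : ℝ, ((-a < b ∨ -a < -b) ∧ (a < b ∨ a < -b)) ↔ |a| < |b| := fun a b => by
    rw [abs_lt, neg_lt (a := |b|), lt_abs, lt_abs]
  ext j
  simp only [decode, jset, cmpPat, probeP, probeM, map_neg, decide_eq_true_eq,
    key, not_lt, Finset.mem_filter, Finset.mem_univ, true_and]

/-! ## §4  Counting the vertices -/

/-- First candidate vertex decoded from a pattern: `d_{S⁺}`. -/
def cand₁ (E : Finset (Fin m)) (π : ↥(probes d) × ↥(probes d) → Bool) : Fin 2 → ℝ :=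
  emb (∑ j ∈ (decode d E π).1, d j)

/-- Second candidate vertex decoded from a pattern: `d_{S⁺ △ J}`. -/
def cand₂ (E : Finset (Fin m)) (π : ↥(probes d) × ↥(probes d) → Bool) : Fin 2 → ℝ :=
  emb (∑ j ∈ (decode d E π).1 ∆ (decode d E π).2, d j)

/-- **Vertex localisation.**  Every vertex of the Newton polygon of the pencil member is one of the
two candidates decoded from the comparison pattern (on the probes `{0, ±d_j}`) of a functional
strictly exposing it. [folklore] -/
theorem extremePoints_subset
    (hd : ∀ S T : Finset (Fin m), ∑ j ∈ S, d j = ∑ j ∈ T, d j → S = T) (hα : ∀ j, α j ≠ 0) :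
    Set.extremePoints ℝ (convexHull ℝ (emb '' ((pencil d α β c).support : Set (Fin 2 →₀ ℕ)))) ⊆
      cand₁ d (coinc α β) '' Set.range (cmpPat (probes d)) ∪
        cand₂ d (coinc α β) '' Set.range (cmpPat (probes d)) := by
  intro v hv
  have hfin : (emb '' ((pencil d α β c).support : Set (Fin 2 →₀ ℕ))).Finite :=
    (Finset.finite_toSet _).image _
  obtain ⟨l, hl⟩ := exists_strict_sep_of_mem_extremePoints_convexHull hfin hv
  obtain ⟨e, he, rfl⟩ := extremePoints_convexHull_subset hv
  obtain ⟨S, rfl⟩ := exists_eq_sum_of_mem_support d α β c he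
  have hS : ¬ coef α β c S = 0 := by
    have := mem_support_iff.mp he
    rwa [coeff_pencil d α β c hd] at this
  have hlin : ∀ T : Finset (Fin m), l (emb (∑ j ∈ T, d j)) = ∑ j ∈ T, l (emb (d j)) := by
    intro T
    rw [emb_sum, map_sum]
  have hmax : ∀ T : Finset (Fin m), ¬ coef α β c T = 0 → T ≠ S →
      ∑ j ∈ T, l (emb (d j)) < ∑ j ∈ S, l (emb (d j)) := by
    intro T hT hTS
    have hmem : emb (∑ j ∈ T, d j) ∈ emb '' ((pencil d α β c).support : Set (Fin 2 →₀ ℕ)) := by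
      refine ⟨_, ?_, rfl⟩
      rw [Finset.mem_coe, mem_support_iff, coeff_pencil d α β c hd]
      exact hT
    have hne : emb (∑ j ∈ T, d j) ≠ emb (∑ j ∈ S, d j) :=
      fun h' => hTS (hd T S (emb_injective h'))
    have := hl _ hmem hne
    rwa [hlin, hlin] at this
  have hcube := eq_splus_or_eq_splus_symmDiff_jset (coinc α β) (fun T => coef α β c T = 0)
    (fun T j hjE hT => coef_symmDiff_singleton_ne_zero α β c hα T j hjE hT)
    (fun T T' hT hsub => coef_eq_zero_of_symmDiff_subset α β c hα T T' hT hsub)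
    (fun j => l (emb (d j))) S hS hmax
  have hπ : cmpPat (probes d) l ∈ Set.range (cmpPat (probes d)) := ⟨l, rfl⟩
  rcases hcube with hc | hc
  · left
    refine ⟨cmpPat (probes d) l, hπ, ?_⟩
    rw [cand₁, decode_cmpPat_fst, ← hc]
  · right
    refine ⟨cmpPat (probes d) l, hπ, ?_⟩
    rw [cand₂, decode_cmpPat_fst, decode_cmpPat_snd, ← hc]

/-- **The bound.**  The Newton polygon of the pencil member has at most `46 (m+1)²` vertices
(only `α_j ≠ 0` and distinct subset sums are used). [folklore] -/
theorem ncard_extremePoints_le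
    (hd : ∀ S T : Finset (Fin m), ∑ j ∈ S, d j = ∑ j ∈ T, d j → S = T) (hα : ∀ j, α j ≠ 0) :
    (Set.extremePoints ℝ (convexHull ℝ
      (emb '' ((pencil d α β c).support : Set (Fin 2 →₀ ℕ))))).ncard ≤ 46 * (m + 1) ^ 2 := by
  have hR : (Set.range (cmpPat (probes d))).Finite := Set.toFinite _
  have h1 := Set.ncard_le_ncard (extremePoints_subset d α β c hd hα)
    ((hR.image _).union (hR.image _))
  have h2 := Set.ncard_union_le (cand₁ d (coinc α β) '' Set.range (cmpPat (probes d)))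
    (cand₂ d (coinc α β) '' Set.range (cmpPat (probes d)))
  have h3 := Set.ncard_image_le (f := cand₁ d (coinc α β)) hR
  have h4 := Set.ncard_image_le (f := cand₂ d (coinc α β)) hR
  have h5 := ncard_range_cmpPat_le (probes d)
  have h6 := Nat.mul_le_mul (card_probes_le d) (card_probes_le d)
  nlinarith [h1, h2, h3, h4, h5, h6]

end

end Summit.ValiantsHypothesis.Theorems.BinomialPencil

namespace Summit.ValiantsHypothesis.Theorems

/-- **`BinomialPencil`** (item stmt-ValiantsHypothesis-5908 of route NewtonUnitEquations), with
`C = 46`: for binomials with common exponents `d_j` having distinct subset sums and `α_j, β_j ≠ 0`,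
`Newt(Π_j (1 + α_j X^{d_j}) − c · Π_j (1 + β_j X^{d_j}))` has at most `46 (m+1)²` vertices.
(The hypothesis `β_j ≠ 0` is not needed.) [folklore; KPTT arXiv:1308.2286 §2 for the setting] -/
theorem binomialPencil_proof :
    Summit.ValiantsHypothesis.ValiantsHypothesis.Theses.NewtonUnitEquations.BinomialPencil := by
  unfold Summit.ValiantsHypothesis.ValiantsHypothesis.Theses.NewtonUnitEquations.BinomialPencil
  refine ⟨46, fun m d α β c hd hα _ => ?_⟩
  exact BinomialPencil.ncard_extremePoints_le d α β c hd hα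

end Summit.ValiantsHypothesis.Theorems
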